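import Summits.Ventures.PercRepro.SixFourIdentities

/-!
# PercRepro — C-025 at `(6,4)`, THEOREM 21.3 IN THE KERNEL: `t = 2` for every rank-`4` set with `g ≥ 9` points (p3, gen 8)

mine-2's `MINE2-RLS.md` §21.3 (`t = 2`, every solid, every `g ≥ 4`): `Σ_{B′ ∈ R₄(G)} 4·w_∞(B′) ≥ (6/5)·N₄(G)` for
`g ≥ 9` (the `g ≤ 8` branch uses the demand bonus `(6/5)(1 + g′)` and is NOT typed here), mine-2's proof in the coloop
vocabulary of `SixFourIdentities.lean`: `σ := 4·w_∞ − 6/5 ∈ {−2/5 (independent 4-set), 14/5, 4/5, 2/15}`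
(`sigma_eq_of_card_four`, `sigma_ge_of_five_le`); with `i₄(C)` the independent `4`-subsets of `C`: `|C| = 5 ⇒
i₄(C) = 5 − m(C)` (`C ∖ x` is dependent iff `x` is a coloop of `M|C`; `i4_eq_of_card_five`) and `σ(C) ≥ (2/45)·i₄(C)`;
`|C| = 6 ⇒ σ(C) ≥ i₄(C)/45` (`i₄ ≤ 15`, and `≤ 6` when `m = 2`: both coloops lie in every independent `4`-subset);
the double counts `Σ_{|C| = k} i₄(C) = C(g − 4, k − 4)·I₄` (`sum_i4_eq`); assembly `Σ σ ≥ (I₄/90)·[(g − 4)(g − 1) − 36]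
≥ 0` (`sum_sigma_nonneg`): THEOREM `six_fifths_N4_le_sum_four_wInf`, `J_two_nonneg_of_nine_le : 0 ≤ J M G 2`
(`M` simple, `G ⊆ E` of rank `4` with `≥ 9` points; flatness of `G` is not needed).
-/

namespace PercRepro.SixFour

open Finset ThmH

variable {α : Type*} [DecidableEq α] {M : Matroid α} [M.Finite] {G : Finset α}

/-! ## `σ`, `i₄`, and the values of `σ` -/

/-- `σ(B′) = 4·w_∞(B′) − 6/5`, the per-set balance at `t = 2`. -/
noncomputable def sigma (M : Matroid α) [M.Finite] (B : Finset α) : ℚ := 4 * wInf M B - 6 / 5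

/-- `i₄(C)`: the independent `4`-subsets of `C`. -/
noncomputable def i4 (M : Matroid α) [M.Finite] (C : Finset α) : ℕ :=
  ((C.powersetCard 4).filter (fun I : Finset α => M.eRk (I : Set α) = 4)).card

/-- `σ = −2/5` on an independent `4`-set. -/
theorem sigma_eq_of_card_four {B : Finset α} (hr : M.eRk (B : Set α) = 4) (hc : B.card = 4) :
    sigma M B = -2 / 5 := by
  unfold sigma wInf
  rw [mTr_eq_four_of_card_eq_four hr hc]
  norm_num

/-- `σ ≥ 2/15` on a rank-`4` set with at least `5` points (`m ≤ 2`). -/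
theorem sigma_ge_of_five_le (hs : Simple M) {B : Finset α} (hB : B ⊆ gr M) (hr : M.eRk (B : Set α) = 4)
    (h5 : 5 ≤ B.card) : 2 / 15 ≤ sigma M B := by
  unfold sigma wInf
  have hm := mTr_le_two_of_five_le hs hB hr h5
  have hm' : (mTr M B : ℚ) ≤ 2 := by exact_mod_cast hm
  have hpos : (0 : ℚ) < 1 + mTr M B := by positivity
  rw [mul_one_div, le_sub_iff_add_le, le_div_iff₀ hpos]
  linarith

/-- `σ` in terms of `m`: `σ = 4/(1 + m) − 6/5`. -/
theorem sigma_eq (B : Finset α) : sigma M B = 4 / (1 + (mTr M B : ℚ)) - 6 / 5 := by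
  unfold sigma wInf
  ring

/-! ## `|C| = 5`: `i₄(C) = 5 − m(C)` -/

omit [DecidableEq α] [M.Finite] in
/-- Adding a point of the closure does not change the rank. -/
theorem eRk_insert_eq_of_mem_closure' {X : Set α} {x : α} (hx : x ∈ M.closure X) :
    M.eRk (insert x X) = M.eRk X := by
  rw [← M.eRk_closure_eq (insert x X), Matroid.closure_insert_eq_of_mem_closure hx, M.eRk_closure_eq]

/-- For a rank-`4` set `C ⊆ E`, a point `x ∈ C` is a coloop of `M|C` iff `C ∖ x` does not have rank `4`. -/
theorem mem_coloopsOf_iff_eRk_erase_ne {C : Finset α} (hC : C ⊆ gr M) (hr : M.eRk (C : Set α) = 4) {x : α}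
    (hx : x ∈ C) : x ∈ coloopsOf M C ↔ ¬ M.eRk ((C.erase x : Finset α) : Set α) = 4 := by
  rw [mem_coloopsOf, and_iff_right hx]
  constructor
  · intro hcl h4
    have := eRk_erase_add_one_of_notMem_closure hC hx hcl
    rw [h4, hr] at this
    exact absurd this (by decide)
  · intro h4 hcl
    apply h4
    have h := eRk_insert_eq_of_mem_closure' (M := M) hcl
    rw [← Finset.coe_insert, Finset.insert_erase hx, hr] at h
    exact h.symm

/-- The `4`-subsets of a `5`-set are the sets `C ∖ x`, `x ∈ C`. -/
theorem powersetCard_four_eq_image_erase {C : Finset α} (hc : C.card = 5) :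
    C.powersetCard 4 = C.image (fun x => C.erase x) := by
  ext I
  rw [Finset.mem_powersetCard, Finset.mem_image]
  constructor
  · rintro ⟨hI, hIc⟩
    have h1 : (C \ I).card = 1 := by rw [Finset.card_sdiff_of_subset hI, hc, hIc]
    obtain ⟨x, hx⟩ := Finset.card_eq_one.1 h1
    refine ⟨x, ?_, ?_⟩
    · have : x ∈ C \ I := by rw [hx]; exact Finset.mem_singleton_self x
      exact (Finset.mem_sdiff.1 this).1
    · rw [← Finset.sdiff_singleton_eq_erase, ← hx, Finset.sdiff_sdiff_eq_self hI]
  · rintro ⟨x, hx, rfl⟩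
    exact ⟨Finset.erase_subset x C, by rw [Finset.card_erase_of_mem hx, hc]⟩

/-- `x ↦ C ∖ x` is injective on `C`. -/
theorem erase_injOn (C : Finset α) : Set.InjOn (fun x => C.erase x) (C : Set α) := by
  intro x hx y hy hxy
  have hxy' : C.erase x = C.erase y := hxy
  by_contra hne
  have : x ∈ C.erase y := Finset.mem_erase.2 ⟨hne, hx⟩
  rw [← hxy'] at this
  exact (Finset.mem_erase.1 this).1 rfl

/-- `i₄(C) = 5 − m(C)` for a rank-`4` set with `5` points. -/
theorem i4_eq_of_card_five {C : Finset α} (hC : C ⊆ gr M) (hr : M.eRk (C : Set α) = 4) (hc : C.card = 5) :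
    i4 M C + mTr M C = 5 := by
  unfold i4 mTr
  rw [powersetCard_four_eq_image_erase hc, Finset.filter_image,
    Finset.card_image_of_injOn ((erase_injOn C).mono (Finset.filter_subset _ _))]
  have hcol : coloopsOf M C = C.filter (fun x => ¬ M.eRk ((C.erase x : Finset α) : Set α) = 4) := by
    ext x
    rw [Finset.mem_filter]
    constructor
    · intro h
      have hx := (mem_coloopsOf.1 h).1
      exact ⟨hx, (mem_coloopsOf_iff_eRk_erase_ne hC hr hx).1 h⟩
    · rintro ⟨hx, h⟩
      exact (mem_coloopsOf_iff_eRk_erase_ne hC hr hx).2 h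
  rw [hcol, Finset.card_filter_add_card_filter_not, hc]

/-- `σ(C) ≥ (2/45)·i₄(C)` for a rank-`4` set with `5` points. -/
theorem sigma_ge_of_card_five (hs : Simple M) {C : Finset α} (hC : C ⊆ gr M) (hr : M.eRk (C : Set α) = 4)
    (hc : C.card = 5) : (2 / 45 : ℚ) * i4 M C ≤ sigma M C := by
  have h5 := i4_eq_of_card_five hC hr hc
  have hm := mTr_le_two_of_five_le hs hC hr (by omega)
  rw [sigma_eq]
  have : mTr M C = 0 ∨ mTr M C = 1 ∨ mTr M C = 2 := by omega
  rcases this with h | h | h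
  · have hi : i4 M C = 5 := by omega
    rw [h, hi]; norm_num
  · have hi : i4 M C = 4 := by omega
    rw [h, hi]; norm_num
  · have hi : i4 M C = 3 := by omega
    rw [h, hi]; norm_num
/-! ## `|C| = 6`: `i₄(C) ≤ 15`, and `≤ 6` when `m(C) = 2` -/

omit [DecidableEq α] in
/-- `i₄(C) ≤ C(|C|, 4)`. -/
theorem i4_le_choose (C : Finset α) : i4 M C ≤ C.card.choose 4 := by
  unfold i4
  rw [← Finset.card_powersetCard 4 C]
  exact Finset.card_filter_le _ _

/-- A `4`-subset of `C` avoiding a coloop of `M|C` is dependent. -/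
theorem eRk_ne_four_of_notMem {C I : Finset α} (hC : C ⊆ gr M) (hr : M.eRk (C : Set α) = 4) (hI : I ⊆ C)
    {x : α} (hx : x ∈ coloopsOf M C) (hxI : x ∉ I) : ¬ M.eRk (I : Set α) = 4 := by
  intro h4
  have hsub : I ⊆ C.erase x := fun y hy => Finset.mem_erase.2 ⟨fun h => hxI (h ▸ hy), hI hy⟩
  have hxC := (mem_coloopsOf.1 hx).1
  have hne := (mem_coloopsOf_iff_eRk_erase_ne hC hr hxC).1 hx
  have hle : M.eRk ((C.erase x : Finset α) : Set α) ≤ 4 := by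
    rw [← hr]
    exact M.eRk_mono (Finset.coe_subset.2 (Finset.erase_subset x C))
  have hge : 4 ≤ M.eRk ((C.erase x : Finset α) : Set α) := by
    rw [← h4]
    exact M.eRk_mono (Finset.coe_subset.2 hsub)
  exact hne (le_antisymm hle hge)

/-- `i₄(C) ≤ 6` for a rank-`4` set with `6` points and two coloops: both lie in every independent `4`-subset. -/
theorem i4_le_six_of_card_six {C : Finset α} (hC : C ⊆ gr M) (hr : M.eRk (C : Set α) = 4)
    (hc : C.card = 6) (hm : mTr M C = 2) : i4 M C ≤ 6 := by
  obtain ⟨p, a, hpa, hpair⟩ := Finset.card_eq_two.1 hm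
  have hp : p ∈ coloopsOf M C := by rw [hpair]; exact Finset.mem_insert_self p _
  have ha : a ∈ coloopsOf M C := by rw [hpair]; exact Finset.mem_insert_of_mem (Finset.mem_singleton_self a)
  have hpC := (mem_coloopsOf.1 hp).1
  have haC := (mem_coloopsOf.1 ha).1
  unfold i4
  calc ((C.powersetCard 4).filter (fun I : Finset α => M.eRk (I : Set α) = 4)).card
      ≤ (((C.erase p).erase a).powersetCard 2).card := by
        refine Finset.card_le_card_of_injOn (fun I => (I.erase p).erase a) ?_ ?_
        · intro I hI
          rw [Finset.coe_filter] at hI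
          obtain ⟨hI, h4⟩ := hI
          obtain ⟨hIC, hIc⟩ := Finset.mem_powersetCard.1 hI
          have hpI : p ∈ I := by
            by_contra hpI
            exact eRk_ne_four_of_notMem hC hr hIC hp hpI h4
          have haI : a ∈ I := by
            by_contra haI
            exact eRk_ne_four_of_notMem hC hr hIC ha haI h4
          rw [Finset.mem_coe, Finset.mem_powersetCard]
          refine ⟨Finset.erase_subset_erase a (Finset.erase_subset_erase p hIC), ?_⟩
          rw [Finset.card_erase_of_mem (Finset.mem_erase.2 ⟨fun h => hpa h.symm, haI⟩),
            Finset.card_erase_of_mem hpI, hIc]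
        · intro I₁ hI₁ I₂ hI₂ heq
          rw [Finset.coe_filter] at hI₁ hI₂
          obtain ⟨hI₁, h4₁⟩ := hI₁
          obtain ⟨hI₂, h4₂⟩ := hI₂
          have hIC₁ := (Finset.mem_powersetCard.1 hI₁).1
          have hIC₂ := (Finset.mem_powersetCard.1 hI₂).1
          have hp₁ : p ∈ I₁ := by
            by_contra h; exact eRk_ne_four_of_notMem hC hr hIC₁ hp h h4₁
          have ha₁ : a ∈ I₁ := by
            by_contra h; exact eRk_ne_four_of_notMem hC hr hIC₁ ha h h4₁
          have hp₂ : p ∈ I₂ := by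
            by_contra h; exact eRk_ne_four_of_notMem hC hr hIC₂ hp h h4₂
          have ha₂ : a ∈ I₂ := by
            by_contra h; exact eRk_ne_four_of_notMem hC hr hIC₂ ha h h4₂
          have heq' : (I₁.erase p).erase a = (I₂.erase p).erase a := heq
          have h1 : insert p (insert a ((I₁.erase p).erase a)) = I₁ := by
            rw [Finset.insert_erase (Finset.mem_erase.2 ⟨fun h => hpa h.symm, ha₁⟩), Finset.insert_erase hp₁]
          have h2 : insert p (insert a ((I₂.erase p).erase a)) = I₂ := by
            rw [Finset.insert_erase (Finset.mem_erase.2 ⟨fun h => hpa h.symm, ha₂⟩), Finset.insert_erase hp₂]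
          rw [← h1, ← h2, heq']
    _ = 6 := by
        rw [Finset.card_powersetCard, Finset.card_erase_of_mem (Finset.mem_erase.2 ⟨fun h => hpa h.symm, haC⟩),
          Finset.card_erase_of_mem hpC, hc]
        rfl

/-- `σ(C) ≥ i₄(C)/45` for a rank-`4` set with `6` points. -/
theorem sigma_ge_of_card_six (hs : Simple M) {C : Finset α} (hC : C ⊆ gr M) (hr : M.eRk (C : Set α) = 4)
    (hc : C.card = 6) : (1 / 45 : ℚ) * i4 M C ≤ sigma M C := by
  have h15 : i4 M C ≤ 15 := by
    have := i4_le_choose (M := M) C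
    rw [hc] at this
    exact this
  have hm := mTr_le_two_of_five_le hs hC hr (by omega)
  rw [sigma_eq]
  have : mTr M C = 0 ∨ mTr M C = 1 ∨ mTr M C = 2 := by omega
  have h15' : (i4 M C : ℚ) ≤ 15 := by exact_mod_cast h15
  rcases this with h | h | h
  · rw [h]; norm_num; linarith
  · rw [h]; norm_num; linarith
  · have h6 := i4_le_six_of_card_six hC hr hc h
    have h6' : (i4 M C : ℚ) ≤ 6 := by exact_mod_cast h6
    rw [h]; norm_num; linarith
/-! ## The double counts `Σ_{|C| = k} i₄(C) = C(g − 4, k − 4)·I₄` -/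

/-- The `k`-supersets of `I` inside `G` are in bijection with the `(k − 4)`-subsets of `G ∖ I`. -/
theorem card_supersets {I : Finset α} (hI : I ⊆ G) (hIc : I.card = 4) {k : ℕ} (hk : 4 ≤ k) :
    ((G.powersetCard k).filter (fun C : Finset α => I ⊆ C)).card = (G.card - 4).choose (k - 4) := by
  have hGI : (G \ I).card = G.card - 4 := by rw [Finset.card_sdiff_of_subset hI, hIc]
  rw [← hGI, ← Finset.card_powersetCard (k - 4) (G \ I)]
  refine Finset.card_nbij' (fun C => C \ I) (fun X => X ∪ I) ?_ ?_ ?_ ?_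
  · intro C hC
    rw [Finset.coe_filter] at hC
    obtain ⟨hC, hIC⟩ := hC
    obtain ⟨hCG, hCc⟩ := Finset.mem_powersetCard.1 hC
    rw [Finset.mem_coe, Finset.mem_powersetCard]
    exact ⟨Finset.sdiff_subset_sdiff hCG le_rfl, by rw [Finset.card_sdiff_of_subset hIC, hCc, hIc]⟩
  · intro X hX
    rw [Finset.mem_coe, Finset.mem_powersetCard] at hX
    obtain ⟨hXG, hXc⟩ := hX
    rw [Finset.mem_coe, Finset.mem_filter, Finset.mem_powersetCard]
    have hdisj : Disjoint X I := Finset.disjoint_of_subset_left hXG Finset.sdiff_disjoint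
    refine ⟨⟨Finset.union_subset (hXG.trans Finset.sdiff_subset) hI, ?_⟩, Finset.subset_union_right⟩
    rw [Finset.card_union_of_disjoint hdisj, hXc, hIc]
    omega
  · intro C hC
    rw [Finset.coe_filter] at hC
    exact Finset.sdiff_union_of_subset hC.2
  · intro X hX
    rw [Finset.mem_coe, Finset.mem_powersetCard] at hX
    have hdisj : Disjoint X I := Finset.disjoint_of_subset_left hX.1 Finset.sdiff_disjoint
    show (X ∪ I) \ I = X
    rw [Finset.union_sdiff_right, Finset.sdiff_eq_self_of_disjoint hdisj]

/-- `Σ_{C ∈ R₄(G), |C| = k} i₄(C) = C(g − 4, k − 4)·I₄` for `k ≥ 4`: both sides count the pairs `(I, C)` with `I` an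
independent `4`-set and `I ⊆ C ⊆ G`, `|C| = k`. -/
theorem sum_i4_eq (hr : M.eRk (G : Set α) = 4) {k : ℕ} (hk : 4 ≤ k) :
    ∑ C ∈ (R4 M G).filter (fun C : Finset α => C.card = k), i4 M C =
      (G.card - 4).choose (k - 4) * I4 M G := by
  unfold i4
  have hcomm := Finset.sum_comm' (s := (R4 M G).filter (fun C : Finset α => C.card = k))
    (t := fun C => (C.powersetCard 4).filter (fun I : Finset α => M.eRk (I : Set α) = 4))
    (t' := (R4 M G).filter (fun I : Finset α => I.card = 4))
    (s' := fun I => (G.powersetCard k).filter (fun C : Finset α => I ⊆ C)) (f := fun _ _ => (1 : ℕ)) ?_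
  · rw [Finset.sum_congr rfl (fun C _ => Finset.card_eq_sum_ones _), hcomm,
      Finset.sum_congr rfl (fun I _ => (Finset.card_eq_sum_ones _).symm),
      Finset.sum_congr rfl (fun I hI => card_supersets (mem_R4.1 (Finset.mem_filter.1 hI).1).1
        (Finset.mem_filter.1 hI).2 hk),
      Finset.sum_const, smul_eq_mul]
    unfold I4
    ring
  · intro C I
    constructor
    · rintro ⟨hC, hI⟩
      rw [Finset.mem_filter, mem_R4] at hC
      rw [Finset.mem_filter, Finset.mem_powersetCard] at hI
      obtain ⟨⟨hCG, -⟩, hCk⟩ := hC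
      obtain ⟨⟨hIC, hIc⟩, hI4⟩ := hI
      refine ⟨?_, ?_⟩
      · rw [Finset.mem_filter, Finset.mem_powersetCard]
        exact ⟨⟨hCG, hCk⟩, hIC⟩
      · rw [Finset.mem_filter, mem_R4]
        exact ⟨⟨hIC.trans hCG, hI4⟩, hIc⟩
    · rintro ⟨hC, hI⟩
      rw [Finset.mem_filter, Finset.mem_powersetCard] at hC
      rw [Finset.mem_filter, mem_R4] at hI
      obtain ⟨⟨hCG, hCk⟩, hIC⟩ := hC
      obtain ⟨⟨-, hI4⟩, hIc⟩ := hI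
      refine ⟨?_, ?_⟩
      · rw [Finset.mem_filter, mem_R4]
        refine ⟨⟨hCG, le_antisymm ?_ ?_⟩, hCk⟩
        · rw [← hr]; exact M.eRk_mono (Finset.coe_subset.2 hCG)
        · rw [← hI4]; exact M.eRk_mono (Finset.coe_subset.2 hIC)
      · rw [Finset.mem_filter, Finset.mem_powersetCard]
        exact ⟨⟨hIC, hIc⟩, hI4⟩

/-! ## Assembly: `Σ σ ≥ 0` for `g ≥ 9` -/

/-- `Σ_{R₄} σ = Σ_{R₄} 4·w_∞ − (6/5)·N₄`. -/
theorem sum_sigma_eq (G : Finset α) :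
    ∑ B ∈ R4 M G, sigma M B = (∑ B ∈ R4 M G, 4 * wInf M B) - 6 / 5 * (N4 M G : ℚ) := by
  unfold sigma N4
  rw [Finset.sum_sub_distrib, Finset.sum_const, nsmul_eq_mul]
  ring

omit [DecidableEq α] in
/-- The sum over `R₄(G)` split by size: `4`, `5`, `6`, `≥ 7` points. -/
theorem sum_R4_split (f : Finset α → ℚ) :
    ∑ B ∈ R4 M G, f B =
      ∑ B ∈ (R4 M G).filter (fun B : Finset α => B.card = 4), f B +
      ∑ B ∈ (R4 M G).filter (fun B : Finset α => B.card = 5), f B +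
      ∑ B ∈ (R4 M G).filter (fun B : Finset α => B.card = 6), f B +
      ∑ B ∈ (R4 M G).filter (fun B : Finset α => 7 ≤ B.card), f B := by
  rw [← Finset.sum_filter_add_sum_filter_not (R4 M G) (fun B : Finset α => B.card = 4),
    ← Finset.sum_filter_add_sum_filter_not ((R4 M G).filter (fun B : Finset α => ¬ B.card = 4))
      (fun B : Finset α => B.card = 5),
    ← Finset.sum_filter_add_sum_filter_not (((R4 M G).filter (fun B : Finset α => ¬ B.card = 4)).filter
      (fun B : Finset α => ¬ B.card = 5)) (fun B : Finset α => B.card = 6)]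
  have e5 : ((R4 M G).filter (fun B : Finset α => ¬ B.card = 4)).filter (fun B : Finset α => B.card = 5) =
      (R4 M G).filter (fun B : Finset α => B.card = 5) := by
    rw [Finset.filter_filter]
    exact Finset.filter_congr (fun B _ => ⟨fun h => h.2, fun h => ⟨by omega, h⟩⟩)
  have e6 : (((R4 M G).filter (fun B : Finset α => ¬ B.card = 4)).filter (fun B : Finset α => ¬ B.card = 5)).filter
      (fun B : Finset α => B.card = 6) = (R4 M G).filter (fun B : Finset α => B.card = 6) := by
    rw [Finset.filter_filter, Finset.filter_filter]
    exact Finset.filter_congr (fun B _ => ⟨fun h => h.2.2, fun h => ⟨by omega, by omega, h⟩⟩)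
  have e7 : (((R4 M G).filter (fun B : Finset α => ¬ B.card = 4)).filter (fun B : Finset α => ¬ B.card = 5)).filter
      (fun B : Finset α => ¬ B.card = 6) = (R4 M G).filter (fun B : Finset α => 7 ≤ B.card) := by
    rw [Finset.filter_filter, Finset.filter_filter]
    refine Finset.filter_congr (fun B hB => ?_)
    have h4 := four_le_card_of_eRk_eq_four (mem_R4.1 hB).2
    constructor
    · rintro ⟨h1, h2, h3⟩; omega
    · intro h; exact ⟨by omega, by omega, by omega⟩
  rw [e5, e6, e7]
  ring

/-- **Theorem 21.3, `g ≥ 9`**: `Σ_{B′ ∈ R₄(G)} σ(B′) ≥ 0`, i.e. `(6/5)·N₄ ≤ Σ 4·w_∞`. -/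
theorem sum_sigma_nonneg (hs : Simple M) (hG : G ⊆ gr M) (hr : M.eRk (G : Set α) = 4) (h9 : 9 ≤ G.card) :
    0 ≤ ∑ B ∈ R4 M G, sigma M B := by
  rw [sum_R4_split]
  -- the four classes
  have h4 : ∑ B ∈ (R4 M G).filter (fun B : Finset α => B.card = 4), sigma M B = -2 / 5 * (I4 M G : ℚ) := by
    rw [Finset.sum_congr rfl (fun B hB => sigma_eq_of_card_four (mem_R4.1 (Finset.mem_filter.1 hB).1).2
      (Finset.mem_filter.1 hB).2), Finset.sum_const, nsmul_eq_mul]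
    unfold I4
    ring
  have h5 : (2 / 45 : ℚ) * (((G.card - 4).choose 1 : ℕ) : ℚ) * (I4 M G : ℚ) ≤
      ∑ B ∈ (R4 M G).filter (fun B : Finset α => B.card = 5), sigma M B := by
    have := Finset.sum_le_sum (fun B hB => sigma_ge_of_card_five hs ((mem_R4.1 (Finset.mem_filter.1 hB).1).1.trans hG)
      (mem_R4.1 (Finset.mem_filter.1 hB).1).2 (Finset.mem_filter.1 hB).2)
    rw [← Finset.mul_sum, ← Nat.cast_sum, sum_i4_eq hr (by norm_num : 4 ≤ 5), Nat.cast_mul] at this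
    rw [mul_assoc]
    exact this
  have h6 : (1 / 45 : ℚ) * (((G.card - 4).choose 2 : ℕ) : ℚ) * (I4 M G : ℚ) ≤
      ∑ B ∈ (R4 M G).filter (fun B : Finset α => B.card = 6), sigma M B := by
    have := Finset.sum_le_sum (fun B hB => sigma_ge_of_card_six hs ((mem_R4.1 (Finset.mem_filter.1 hB).1).1.trans hG)
      (mem_R4.1 (Finset.mem_filter.1 hB).1).2 (Finset.mem_filter.1 hB).2)
    rw [← Finset.mul_sum, ← Nat.cast_sum, sum_i4_eq hr (by norm_num : 4 ≤ 6), Nat.cast_mul] at this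
    rw [mul_assoc]
    exact this
  have h7 : 0 ≤ ∑ B ∈ (R4 M G).filter (fun B : Finset α => 7 ≤ B.card), sigma M B :=
    Finset.sum_nonneg (fun B hB => le_trans (by norm_num) (sigma_ge_of_five_le hs
      ((mem_R4.1 (Finset.mem_filter.1 hB).1).1.trans hG) (mem_R4.1 (Finset.mem_filter.1 hB).1).2
      (by have := (Finset.mem_filter.1 hB).2; omega)))
  -- the numbers: `(g − 4) ≥ 5` and `C(g − 4, 2) ≥ 10`
  have hp : (5 : ℚ) ≤ (((G.card - 4).choose 1 : ℕ) : ℚ) := by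
    rw [Nat.choose_one_right]
    exact_mod_cast (by omega : 5 ≤ G.card - 4)
  have hq : (10 : ℚ) ≤ (((G.card - 4).choose 2 : ℕ) : ℚ) := by
    have : Nat.choose 5 2 ≤ (G.card - 4).choose 2 := Nat.choose_le_choose 2 (by omega)
    exact_mod_cast this
  have hx : (0 : ℚ) ≤ I4 M G := Nat.cast_nonneg _
  have hbr : 0 ≤ (I4 M G : ℚ) * (-2 / 5 + 2 / 45 * (((G.card - 4).choose 1 : ℕ) : ℚ) +
      1 / 45 * (((G.card - 4).choose 2 : ℕ) : ℚ)) := mul_nonneg hx (by linarith)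
  nlinarith [h4, h5, h6, h7, hbr]

/-- **Theorem 21.3 (`t = 2`, `g ≥ 9`)**: `(6/5)·N₄(G) ≤ Σ_{B′ ∈ R₄(G)} 4·w_∞(B′)`. -/
theorem six_fifths_N4_le_sum_four_wInf (hs : Simple M) (hG : G ⊆ gr M) (hr : M.eRk (G : Set α) = 4)
    (h9 : 9 ≤ G.card) : 6 / 5 * (N4 M G : ℚ) ≤ ∑ B ∈ R4 M G, 4 * wInf M B := by
  have := sum_sigma_nonneg hs hG hr h9
  rw [sum_sigma_eq] at this
  linarith

/-- `(J₂^∞)` for `g ≥ 9`: `0 ≤ J M G 2`. -/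
theorem J_two_nonneg_of_nine_le (hs : Simple M) (hG : G ⊆ gr M) (hr : M.eRk (G : Set α) = 4)
    (h9 : 9 ≤ G.card) : 0 ≤ J M G 2 := by
  unfold J
  have h := six_fifths_N4_le_sum_four_wInf hs hG hr h9
  have hdf : (0 : ℚ) ≤ DF M G 2 := Nat.cast_nonneg _
  have : ∑ B ∈ R4 M G, ((6 : ℚ) - (2 : ℕ)) * wInf M B = ∑ B ∈ R4 M G, 4 * wInf M B := by
    refine Finset.sum_congr rfl (fun B _ => ?_)
    norm_num
  rw [this]
  linarith

end PercRepro.SixFour
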